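import Literature.IUT.HodgeArakelov.BadPrimeGaussianMonoidsRestrictionIsoKummerGenericProofs

/-!
# [IUTchII] Prop 3.1 (i) «splittings up to torsion» of the theta monoids `Ψ^ι_env`, `∞Ψ^ι_env` DERIVED from the theta
# EVALUATION at one label — the divisor-map input (J3) of the splitting clause replaced by the Cor 3.5 inputs (K)(R)(E)

S. Mochizuki, *Inter-universal Teichmüller theory II*, kurims Dec-2020 manuscript, Prop 3.1 (i) p. 87 ("a functorial
algorithm for constructing the splittings up to torsion determined by the subsets `M^×_TM(M^Θ_*)`, `θ^ι_env(M^Θ_*)`,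
`∞θ^ι_env(M^Θ_*)` [cf. Corollary 2.8, (iii)]"), Cor 3.5 (i)/(ii) pp. 94–95, Rmk 2.5.1 (i) p. 72 (the theta value `q_v^{j²}`,
a non-unit for `j ≠ 0`) [cite: Mochizuki2012, Prop 3.1 (i) p.87]. Claim key DISPUTED (D-0012). PROOF-ONLY companion (abc-iut cell,
layer L6, seat abc-iut-w4-d004 gen 3; nodes **IUTchII:Prop3.1(i)** splitting clause = sub-DAG row P31.i.r4 / junction J3,
and IUTchII:Cor3.5(ii)). NO definition, NO `Prop` fact, NO instance.

WHAT IS IN THE TREE. abc-iut-L6-t2's typed clause `TemperedThetaMonoids.Prop31Statements.splitting`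
(`IsSplittingUpToTorsion M^×_TM (closure ∞θ^ι_env)`: an element of `M^×_TM` lying in the monoid generated by `∞θ^ι_env` is
TORSION) is discharged by abc-iut-L6-d3's `thetaEnv_splitting_of_val` MODULO a divisor map `v` on the ambient module
(`v(M^×_TM) = 1`, `1 < v` on `∞θ^ι_env`; junction J3 of `plan/L6/SUBDAG-IUTchII-Prop-31-33-34.md`: "[EtTh] Prop 1.4
«ord(Θ) > 0» at the model").

WHAT THIS FILE PROVES (generic over the Prop 3.1 input record `E` with the Kummer junction data of abc-iut-w4-d004's
restriction-isomorphism files — ANY constant monoid `M₀` with injective Kummer map `κ`, `Ψ_cns = κ(M₀)`):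
* `theta_pow_not_mem_units_of_eval` — **no positive power of `θ` is a unit**: if at ONE label `t₀` the restriction
  `R : Ψ^ι_env → M` satisfies (R) `R (κ m) = κ₀ m` and (E) `R θ = κ₀ q` with `κ₀` injective and `q` a NON-UNIT of `M₀`
  (positive valuation), then `θ^n ∉ M^×_TM` for `n ≥ 1` (else `q^n` would be a unit);
* `isSplittingUpToTorsion_thetaEnv_of_eval` — with `horb` (`θ^ι_env = M^×_TM·θ`): `M^×_TM ∩ ⟨θ^ι_env⟩ = {1}`, hence the
  splitting up to torsion of `Ψ^ι_env`;
* `isSplittingUpToTorsion_inftyThetaEnv_of_eval` — with the SHARP root condition `hrootsθ : ∀ ϑ ∈ ∞θ^ι_env, ∃ N > 0,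
  ∃ v ∈ M^×_TM, ϑ^N = v·θ` (print's Prop 1.4 definition of `∞θ`; at abc-iut-w4-d019's produced record it is abc-iut-w5-d192's
  `exists_pow_eq_unit_mul_of_mem_toRecord_inftyThetaEnv'` from `horb` + `htors`): `M^×_TM ∩ ⟨∞θ^ι_env⟩ = {1}`, hence
  **the typed clause `IsSplittingUpToTorsion M^×_TM (closure ∞θ^ι_env)` — J3 DERIVED from (K)(R)(E)**, the inputs of the
  Cor 3.5 (ii) restriction isomorphism (all theorems at the genuine record except (E), abc-iut-w4-d004
  `…GenuineRecordRestrictionIso{Proofs,Padic,Family}`).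
Nothing here asserts a disputed claim or takes a side on [IUTchIII] Cor 3.12; typed ≠ proved ≠ endorsed.
-/

namespace Literature.IUT.HodgeArakelov

namespace BadPrimeGaussianMonoids

open TemperedThetaMonoids

universe u v w

section SplittingOfEvaluation

variable {Q : Type u} [Group Q] (E : TemperedThetaMonoids.ThetaEnvData.{u, v} Q) {M₀ : Type*} [CommMonoid M₀]
  (κ : M₀ →* E.H) {M : Type w} [CommMonoid M] (κ₀ : M₀ →* M) {ι : E.Iota} {θ : E.H}
  (R : E.thetaMonoid ι →* M) (q : M₀)

/-- **No positive power of `θ` is a unit of `Ψ_cns`.** At one label, (R) `R (κ m) = κ₀ m`, (E) `R θ = κ₀ q` with `κ₀`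
injective and `q` a NON-UNIT of the constant monoid (positive valuation, Rmk 2.5.1 (i)): `θ^n ∈ M^×_TM` with `n ≥ 1` would
give `κ₀ (q^n) = κ₀ m` for a unit `m`, i.e. `q^n` a unit. [cite: Mochizuki2012, Prop 3.1 (i) p.87] -/
theorem theta_pow_not_mem_units_of_eval (hκ : Function.Injective κ) (hcns : E.constantMonoid = MonoidHom.mrange κ)
    (hθ : θ ∈ E.thetaEnv ι) (hRκ : ∀ (m : M₀) (hm : κ m ∈ E.thetaMonoid ι), R ⟨κ m, hm⟩ = κ₀ m)
    (hRθ : R ⟨θ, thetaEnv_subset_thetaMonoid E ι hθ⟩ = κ₀ q) (hκ₀ : Function.Injective κ₀) (hq : ¬ IsUnit q)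
    {n : ℕ} (hn : n ≠ 0) : θ ^ n ∉ E.units := by
  intro hmem
  obtain ⟨m, hm⟩ := exists_unit_eq_of_mem_units E κ hκ hcns (θ ^ n) hmem
  have h1 : R (⟨θ, thetaEnv_subset_thetaMonoid E ι hθ⟩ ^ n) = κ₀ (q ^ n) := by rw [map_pow, hRθ, map_pow]
  have h2 : (⟨θ, thetaEnv_subset_thetaMonoid E ι hθ⟩ ^ n : E.thetaMonoid ι) =
      ⟨κ (m : M₀), kummer_unit_mem_thetaMonoid_gen E κ hκ hcns m⟩ := by
    apply Subtype.ext
    change ((⟨θ, thetaEnv_subset_thetaMonoid E ι hθ⟩ ^ n : E.thetaMonoid ι) : E.H) = κ (m : M₀)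
    rw [SubmonoidClass.coe_pow]
    exact hm.symm
  rw [h2, hRκ] at h1
  have h3 : q ^ n = (m : M₀) := hκ₀ h1.symm
  exact hq ((isUnit_pow_iff hn).mp (h3 ▸ m.isUnit))

/-- Every element of the monoid `⟨θ^ι_env⟩` generated by `θ^ι_env = M^×_TM · θ` (`horb`) is `u · θ^k` with `u ∈ M^×_TM` and
`k` the number of generators used — in particular `k = 0` only for `1`. [cite: Mochizuki2012, Prop 3.1 (i) p.87] -/
theorem exists_unit_mul_theta_pow_of_mem_closure (horb : ∀ θ' ∈ E.thetaEnv ι, ∃ u ∈ E.units, θ' = u * θ)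
    {x : E.H} (hx : x ∈ Submonoid.closure (E.thetaEnv ι)) :
    ∃ (k : ℕ) (u : E.H), u ∈ E.units ∧ x = u * θ ^ k ∧ (k = 0 → x = 1) := by
  induction hx using Submonoid.closure_induction with
  | mem y hy =>
    obtain ⟨u, hu, rfl⟩ := horb y hy
    exact ⟨1, u, hu, by rw [pow_one], fun h => absurd h one_ne_zero⟩
  | one => exact ⟨0, 1, E.units.one_mem, by rw [pow_zero, one_mul], fun _ => rfl⟩
  | mul y z _ _ hy hz =>
    obtain ⟨k, u, hu, rfl, hk⟩ := hy
    obtain ⟨k', u', hu', rfl, hk'⟩ := hz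
    refine ⟨k + k', u * u', E.units.mul_mem hu hu', by rw [pow_add]; simp only [mul_assoc, mul_left_comm], fun h => ?_⟩
    obtain ⟨h0, h0'⟩ := Nat.add_eq_zero_iff.mp h
    rw [hk h0, hk' h0', one_mul]

/-- **The splitting up to torsion of `Ψ^ι_env = M^×_TM · θ^ι_env^ℕ`, from the theta evaluation**: `M^×_TM ∩ ⟨θ^ι_env⟩`
consists of torsion elements (in fact of `1` alone) — no divisor map needed, only (K)(R)(E) at one label with a non-unit
value and `horb`. [cite: Mochizuki2012, Prop 3.1 (i) p.87] -/
theorem isSplittingUpToTorsion_thetaEnv_of_eval (hκ : Function.Injective κ)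
    (hcns : E.constantMonoid = MonoidHom.mrange κ) (hθ : θ ∈ E.thetaEnv ι)
    (horb : ∀ θ' ∈ E.thetaEnv ι, ∃ u ∈ E.units, θ' = u * θ)
    (hRκ : ∀ (m : M₀) (hm : κ m ∈ E.thetaMonoid ι), R ⟨κ m, hm⟩ = κ₀ m)
    (hRθ : R ⟨θ, thetaEnv_subset_thetaMonoid E ι hθ⟩ = κ₀ q) (hκ₀ : Function.Injective κ₀) (hq : ¬ IsUnit q) :
    IsSplittingUpToTorsion E.units (Submonoid.closure (E.thetaEnv ι)) := by
  refine ⟨fun x hxU hxS => ?_⟩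
  obtain ⟨k, u, hu, hx, hk⟩ := exists_unit_mul_theta_pow_of_mem_closure E horb hxS
  by_cases hk0 : k = 0
  · rw [hk hk0]
    exact IsOfFinOrder.one
  · exfalso
    refine theta_pow_not_mem_units_of_eval E κ κ₀ R q hκ hcns hθ hRκ hRθ hκ₀ hq hk0 ?_
    have h : θ ^ k = u⁻¹ * x := by rw [hx, inv_mul_cancel_left]
    rw [h]
    exact E.units.mul_mem (E.units.inv_mem hu) hxU

/-- Every element of the monoid `⟨∞θ^ι_env⟩` has a positive power of the form `u · θ^j`, `u ∈ M^×_TM`, with `j = 0` only for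
`1` — from the SHARP root condition `ϑ^N = v·θ` (`N ≥ 1`) on the generators. [cite: Mochizuki2012, Prop 3.1 (i) p.87] -/
theorem exists_pow_eq_unit_mul_theta_pow_of_mem_closure_infty
    (hrootsθ : ∀ ϑ ∈ E.inftyThetaEnv ι, ∃ N : ℕ, 0 < N ∧ ∃ v ∈ E.units, ϑ ^ N = v * θ)
    {x : E.H} (hx : x ∈ Submonoid.closure (E.inftyThetaEnv ι)) :
    ∃ (N : ℕ), 0 < N ∧ ∃ (j : ℕ) (u : E.H), u ∈ E.units ∧ x ^ N = u * θ ^ j ∧ (j = 0 → x = 1) := by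
  induction hx using Submonoid.closure_induction with
  | mem y hy =>
    obtain ⟨N, hN, v, hv, hyN⟩ := hrootsθ y hy
    exact ⟨N, hN, 1, v, hv, by rw [pow_one, hyN], fun h => absurd h one_ne_zero⟩
  | one => exact ⟨1, Nat.one_pos, 0, 1, E.units.one_mem, by rw [one_pow, pow_zero, one_mul], fun _ => rfl⟩
  | mul y z _ _ hy hz =>
    obtain ⟨N, hN, j, u, hu, hyN, hj⟩ := hy
    obtain ⟨N', hN', j', u', hu', hzN, hj'⟩ := hz
    refine ⟨N * N', Nat.mul_pos hN hN', j * N' + j' * N, u ^ N' * u' ^ N,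
      E.units.mul_mem (E.units.pow_mem hu N') (E.units.pow_mem hu' N), ?_, fun h => ?_⟩
    · rw [mul_pow, pow_mul, hyN, mul_comm N N', pow_mul, hzN, mul_pow, mul_pow, ← pow_mul, ← pow_mul, pow_add]
      simp only [mul_assoc, mul_left_comm]
    · have hjz : j = 0 := by
        rcases Nat.eq_zero_or_pos j with h0 | hpos
        · exact h0
        · exfalso; have := Nat.mul_pos hpos hN'; omega
      have hjz' : j' = 0 := by
        rcases Nat.eq_zero_or_pos j' with h0 | hpos
        · exact h0
        · exfalso; have := Nat.mul_pos hpos hN; omega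
      rw [hj hjz, hj' hjz', one_mul]

/-- **The splitting up to torsion of `∞Ψ^ι_env = M^×_TM · ∞θ^ι_env^ℕ`, from the theta evaluation** — the typed clause
`TemperedThetaMonoids.Prop31Statements.splitting ι` (`IsSplittingUpToTorsion M^×_TM (closure ∞θ^ι_env)`): `M^×_TM ∩ ⟨∞θ^ι_env⟩`
consists of torsion elements (in fact of `1` alone), from (K)(R)(E) at one label with a non-unit value and the sharp root
condition `hrootsθ` (Prop 1.4's definition of `∞θ`). Replaces the divisor-map input of abc-iut-L6-d3's
`thetaEnv_splitting_of_val` (junction J3) by the Cor 3.5 inputs. [cite: Mochizuki2012, Prop 3.1 (i) p.87] -/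
theorem isSplittingUpToTorsion_inftyThetaEnv_of_eval (hκ : Function.Injective κ)
    (hcns : E.constantMonoid = MonoidHom.mrange κ) (hθ : θ ∈ E.thetaEnv ι)
    (hrootsθ : ∀ ϑ ∈ E.inftyThetaEnv ι, ∃ N : ℕ, 0 < N ∧ ∃ v ∈ E.units, ϑ ^ N = v * θ)
    (hRκ : ∀ (m : M₀) (hm : κ m ∈ E.thetaMonoid ι), R ⟨κ m, hm⟩ = κ₀ m)
    (hRθ : R ⟨θ, thetaEnv_subset_thetaMonoid E ι hθ⟩ = κ₀ q) (hκ₀ : Function.Injective κ₀) (hq : ¬ IsUnit q) :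
    IsSplittingUpToTorsion E.units (Submonoid.closure (E.inftyThetaEnv ι)) := by
  refine ⟨fun x hxU hxS => ?_⟩
  obtain ⟨N, _, j, u, hu, hxN, hj⟩ := exists_pow_eq_unit_mul_theta_pow_of_mem_closure_infty E hrootsθ hxS
  by_cases hj0 : j = 0
  · rw [hj hj0]
    exact IsOfFinOrder.one
  · exfalso
    refine theta_pow_not_mem_units_of_eval E κ κ₀ R q hκ hcns hθ hRκ hRθ hκ₀ hq hj0 ?_
    have h : θ ^ j = u⁻¹ * x ^ N := by rw [hxN, inv_mul_cancel_left]
    rw [h]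
    exact E.units.mul_mem (E.units.inv_mem hu) (E.units.pow_mem hxU N)

/-- The two splittings together, in the label-wise restriction shape of abc-iut-w4-d004's iso clause
(`R_t : Ψ^ι_env → M` for a family of labels, evaluation at `t₀` with `q_{t₀}` a non-unit).
[cite: Mochizuki2012, Prop 3.1 (i) p.87] -/
theorem isSplittingUpToTorsion_both_of_eval {T : Type*} (Rf : T → (E.thetaMonoid ι →* M)) (qf : T → M₀)
    (hκ : Function.Injective κ) (hcns : E.constantMonoid = MonoidHom.mrange κ) (hθ : θ ∈ E.thetaEnv ι)
    (horb : ∀ θ' ∈ E.thetaEnv ι, ∃ u ∈ E.units, θ' = u * θ)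
    (hrootsθ : ∀ ϑ ∈ E.inftyThetaEnv ι, ∃ N : ℕ, 0 < N ∧ ∃ v ∈ E.units, ϑ ^ N = v * θ)
    (hRκ : ∀ (t : T) (m : M₀) (hm : κ m ∈ E.thetaMonoid ι), Rf t ⟨κ m, hm⟩ = κ₀ m)
    (hRθ : ∀ t, Rf t ⟨θ, thetaEnv_subset_thetaMonoid E ι hθ⟩ = κ₀ (qf t)) (hκ₀ : Function.Injective κ₀) (t₀ : T)
    (hq : ¬ IsUnit (qf t₀)) :
    IsSplittingUpToTorsion E.units (Submonoid.closure (E.thetaEnv ι)) ∧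
      IsSplittingUpToTorsion E.units (Submonoid.closure (E.inftyThetaEnv ι)) :=
  ⟨isSplittingUpToTorsion_thetaEnv_of_eval E κ κ₀ (Rf t₀) (qf t₀) hκ hcns hθ horb (hRκ t₀) (hRθ t₀) hκ₀ hq,
    isSplittingUpToTorsion_inftyThetaEnv_of_eval E κ κ₀ (Rf t₀) (qf t₀) hκ hcns hθ hrootsθ (hRκ t₀) (hRθ t₀) hκ₀ hq⟩

end SplittingOfEvaluation

end BadPrimeGaussianMonoids

end Literature.IUT.HodgeArakelov
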